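import Literature.AlgebraicGeometry.Motives.HodgeLieWeightOnePlusLineSl2Triple
import Literature.AlgebraicGeometry.Motives.HodgeLieWeightOnePlusLineTwistedTrace
import Literature.Algebra.Lie.Sl2StandardIsotypic
import HarnessLib

/-!
# Weight one, type-III position, `Lie Hg` `ℚ`-simple of dimension `6`: the compact factor `𝔨` acts through the standard `sl₂`

Family `hodge`, layer `Literature/AlgebraicGeometry/Motives`; THEOREMS ONLY (no definition, no named fact; D-0026).
Sequel of `HodgeLieWeightOnePlusLineSl2Triple` and `HodgeLieWeightOnePlusLineTwistedTrace` for the cell `pub-hodgecm2`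
(COR-CM) lane MT-RANK-SEVEN-TYPEIII, seat `b27`.

SETTING (type III): `H` polarizable of weight `1` on `V` (`d = dim_ℚ V`), graded basis `e`, Hodge projector `P`, plus-line
hypotheses, `𝔷 = 0`, `𝔥 = Lie Hg(H)` simple over `ℚ` of dimension `6`; `𝔥_ℂ = 𝔰 ⊕ 𝔨` and `(h′, e′, f′)` an `sl₂`-triple
spanning `𝔨` with `tr(h′²) = d`, `2 tr(e′f′) = d` (`HodgeLieWeightOnePlusLineSl2Triple`); `𝒞 = End_Hdg(V) ⊗ ℂ =
span_ℂ {a_ℂ : a ∈ End_Hdg}` the commutant of `𝔥_ℂ`; `C = 4f′e′ + h′² + 2h′` the Casimir operator of the triple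
(`Literature.Algebra.Lie.Sl2.casimir`).

THE CASIMIR ARGUMENT.
* **`trace_mul_casimir_sub_three_eq_zero`** — `tr(z (C − 3)) = 0` for every `z ∈ 𝒞`: by the twisted trace identity
  `d · tr(z x y) = tr z · tr(x y)` (`finrank_mul_trace_mul_mul_eq_of_mem_spanC_endAlg`) one gets `tr(z h′²) = tr z`,
  `2 tr(z f′e′) = tr z`, `tr(z h′) = 0`.
* **`casimir_sub_three_mem_spanC_endAlg`** — `C − 3 ∈ 𝒞` (it commutes with `E, F, Θ` and, by `Sl2CasimirCommute`, with
  `h′, e′, f′`, hence with `𝔥_ℂ`; `mem_span_endAlg_of_forall_commute`).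
* **`eq_zero_of_mem_spanC_endAlg_of_forall_trace_mul_eq_zero`** — (any weight) the trace form `tr(z z′)` is non-degenerate
  on `𝒞`: degeneracy descends to `End_Hdg` (`exists_ne_zero_orthogonal_of_spanC`), where `tr(a† a) > 0` (Rosati positivity,
  `Polarization.trace_adjoint_mul_self_pos`).
* **`casimir_eq_three_of_plusLine`** — hence `C = 3`; **`standardForm_of_plusLine`** — so (`Sl2StandardIsotypic`)
  `h′² = 1`, `e′² = f′² = 0`, `e′f′ = ½(1 + h′)`, `f′e′ = ½(1 − h′)`, `h′e′ = e′ = −e′h′`, `h′f′ = −f′ = −f′h′`: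
  `V_ℂ` is an isotypic sum of standard representations of `𝔨 ≅ sl₂(ℂ)`, exactly as for `𝔰`.

## References

* [MoonenZarhin1999LowDim] B. Moonen, Yu. Zarhin, *Hodge classes on abelian varieties of low dimension*, Math. Ann. 315
  (1999), §2 (2.3) Type III.
* [Deligne1982HodgeCycles] P. Deligne, *Hodge cycles on abelian varieties*, LNM 900 (1982), I §3 (3.4–3.6).
* [FultonHarris1991] W. Fulton, J. Harris, GTM 129 (1991), Lecture 11 (§11.1).
* [Moonen2017FamiliesMotives] B. Moonen, *Families of motives and the Mumford–Tate conjecture* (2017), §2.1.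
-/

noncomputable section

open scoped TensorProduct

namespace Literature.AlgebraicGeometry.Motives

universe u

namespace HodgeStructure

open ProjectorBlocks Literature.RepresentationTheory.GeneralLinear Literature.Algebra.Lie.Sl2

variable {V : Type u} [AddCommGroup V] [Module ℚ V] [Module.Finite ℚ V] [HodgeTensorFacts.{u, u}] {n : ℤ}
  {S : Type u} [Fintype S] [DecidableEq S] {deg : S → ℤ}

/-! ## §1 `tr(z (C − 3)) = 0` on the commutant -/

/-- **`tr_{V_ℂ}(z (C − 3)) = 0` for all `z ∈ 𝒞 = End_Hdg ⊗ ℂ`**, `C = 4f′e′ + h′² + 2h′` the Casimir operator of an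
`sl₂`-triple `(h′, e′, f′)` in `𝔥_ℂ` with `tr(h′²) = d`, `2 tr(e′f′) = d` (`d = dim_ℚ V`): the twisted trace identity
`d · tr(z x y) = tr z · tr(x y)` gives `tr(z h′²) = tr z`, `2 tr(z f′e′) = tr z` and `tr(z h′) = tr(z(e′f′ − f′e′)) = 0`.
[cite: MoonenZarhin1999LowDim, §2 (2.3)] [cite: Deligne1982HodgeCycles, I §3 (3.4–3.6)] -/
theorem trace_mul_casimir_sub_three_eq_zero (H : HodgeStructure V n) (ψ : H.Polarization) (hn : n = 1)
    (e : Module.Basis S ℂ (ℂ ⊗[ℚ] V)) (hF : ∀ a, H.F a = Submodule.span ℂ (e '' {σ | a ≤ deg σ}))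
    (hFc : ∀ a, complexConj (H.F a) = Submodule.span ℂ (e '' {σ | deg σ ≤ n - a}))
    (hdeg : ∀ σ, deg σ = 0 ∨ deg σ = 1) {X : Module.End ℚ V} (hX : X ∈ H.hodgeLie) (hXE : X ∉ H.endAlg)
    (hplus : ∀ Y ∈ H.hodgeLieC, ∃ c : ℂ,
      gradingEnd e deg * Y * (1 - gradingEnd e deg) = c • (gradingEnd e deg * X.baseChange ℂ * (1 - gradingEnd e deg)))
    (hminus : ∀ Y ∈ H.hodgeLieC, ∃ c : ℂ,
      (1 - gradingEnd e deg) * Y * gradingEnd e deg = c • ((1 - gradingEnd e deg) * X.baseChange ℂ * gradingEnd e deg))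
    (hz : H.hodgeLie ⊓ Subalgebra.toSubmodule H.endAlg = ⊥)
    (hsimple : letI : LieRing (Module.End ℚ V) := LieRing.ofAssociativeRing
      ∀ 𝔏 : LieSubalgebra ℚ (Module.End ℚ V), 𝔏.toSubmodule = H.hodgeLie → LieAlgebra.IsSimple ℚ 𝔏)
    {h' e' f' : Module.End ℂ (ℂ ⊗[ℚ] V)} (hhM : h' ∈ H.hodgeLieC) (heM : e' ∈ H.hodgeLieC) (hfM : f' ∈ H.hodgeLieC)
    (hef : e' * f' - f' * e' = h') (htrh : LinearMap.trace ℂ (ℂ ⊗[ℚ] V) (h' * h') = (Module.finrank ℚ V : ℂ))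
    (htref : 2 * LinearMap.trace ℂ (ℂ ⊗[ℚ] V) (e' * f') = (Module.finrank ℚ V : ℂ))
    {z : Module.End ℂ (ℂ ⊗[ℚ] V)}
    (hzm : z ∈ Submodule.span ℂ ((fun c : Module.End ℚ V => c.baseChange ℂ) '' (H.endAlg : Set (Module.End ℚ V)))) :
    LinearMap.trace ℂ (ℂ ⊗[ℚ] V) (z * (casimir h' e' f' - (3 : ℂ) • 1)) = 0 := by
  have hd0 : (Module.finrank ℚ V : ℂ) ≠ 0 := by
    intro h
    have h0 : Module.finrank ℚ V = 0 := by exact_mod_cast h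
    haveI := Module.finrank_zero_iff.1 h0
    exact hXE (by rw [show X = 0 from LinearMap.ext fun v => Subsingleton.elim _ _]; exact zero_mem _)
  have h1 := finrank_mul_trace_mul_mul_eq_of_mem_spanC_endAlg H ψ hn e hF hFc hdeg hX hXE hplus hminus hz hsimple hzm hhM hhM
  have h2 := finrank_mul_trace_mul_mul_eq_of_mem_spanC_endAlg H ψ hn e hF hFc hdeg hX hXE hplus hminus hz hsimple hzm hfM heM
  have h3 := finrank_mul_trace_mul_mul_eq_of_mem_spanC_endAlg H ψ hn e hF hFc hdeg hX hXE hplus hminus hz hsimple hzm heM hfM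
  rw [htrh] at h1
  rw [LinearMap.trace_mul_comm ℂ f' e'] at h2
  rw [mul_assoc] at h1 h2 h3
  have hzh : LinearMap.trace ℂ (ℂ ⊗[ℚ] V) (z * h') =
      LinearMap.trace ℂ (ℂ ⊗[ℚ] V) (z * (e' * f')) - LinearMap.trace ℂ (ℂ ⊗[ℚ] V) (z * (f' * e')) := by
    conv_lhs => rw [← hef]
    rw [mul_sub, map_sub]
  have hexp : LinearMap.trace ℂ (ℂ ⊗[ℚ] V) (z * (casimir h' e' f' - (3 : ℂ) • 1)) =
      4 * LinearMap.trace ℂ (ℂ ⊗[ℚ] V) (z * (f' * e')) + LinearMap.trace ℂ (ℂ ⊗[ℚ] V) (z * (h' * h')) +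
        2 * LinearMap.trace ℂ (ℂ ⊗[ℚ] V) (z * h') - 3 * LinearMap.trace ℂ (ℂ ⊗[ℚ] V) z := by
    simp only [casimir, mul_sub, mul_add, mul_smul_comm, mul_one, map_sub, map_add, map_smul, smul_eq_mul]
  have key : (Module.finrank ℚ V : ℂ) * LinearMap.trace ℂ (ℂ ⊗[ℚ] V) (z * (casimir h' e' f' - (3 : ℂ) • 1)) = 0 := by
    rw [hexp, hzh]
    linear_combination 2 * h2 + h1 + 2 * h3 + (2 * LinearMap.trace ℂ (ℂ ⊗[ℚ] V) z) * htref
  exact (mul_eq_zero.1 key).resolve_left hd0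

/-! ## §2 `C − 3` lies in the commutant -/

/-- **The Casimir operator `C = 4f′e′ + h′² + 2h′` of an `sl₂`-triple spanning `𝔨` commutes with `𝔥_ℂ`, so
`C − 3 ∈ 𝒞 = End_Hdg ⊗ ℂ`**: `C` commutes with `E, F, Θ` (as `h′, e′, f′ ∈ 𝔨` do, `commute_of_plusLine`) and with
`h′, e′, f′` (`Sl2CasimirCommute`), hence with `𝔥_ℂ = ℂE ⊕ ℂF ⊕ ℂΘ ⊕ 𝔨`; then `mem_span_endAlg_of_forall_commute`.
[cite: MoonenZarhin1999LowDim, §2 (2.3)] [cite: FultonHarris1991, Lecture 11 (§11.1)] -/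
theorem casimir_sub_three_mem_spanC_endAlg (H : HodgeStructure V n) (ψ : H.Polarization) (hn : n = 1)
    (e : Module.Basis S ℂ (ℂ ⊗[ℚ] V)) (hF : ∀ a, H.F a = Submodule.span ℂ (e '' {σ | a ≤ deg σ}))
    (hFc : ∀ a, complexConj (H.F a) = Submodule.span ℂ (e '' {σ | deg σ ≤ n - a}))
    (hdeg : ∀ σ, deg σ = 0 ∨ deg σ = 1) {X : Module.End ℚ V} (hX : X ∈ H.hodgeLie) (hXE : X ∉ H.endAlg)
    (hplus : ∀ Y ∈ H.hodgeLieC, ∃ c : ℂ,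
      gradingEnd e deg * Y * (1 - gradingEnd e deg) = c • (gradingEnd e deg * X.baseChange ℂ * (1 - gradingEnd e deg)))
    (hminus : ∀ Y ∈ H.hodgeLieC, ∃ c : ℂ,
      (1 - gradingEnd e deg) * Y * gradingEnd e deg = c • ((1 - gradingEnd e deg) * X.baseChange ℂ * gradingEnd e deg))
    (hz : H.hodgeLie ⊓ Subalgebra.toSubmodule H.endAlg = ⊥) {h' e' f' : Module.End ℂ (ℂ ⊗[ℚ] V)}
    (hhP : h' * gradingEnd e deg = gradingEnd e deg * h')
    (hhE : h' * (gradingEnd e deg * X.baseChange ℂ * (1 - gradingEnd e deg)) =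
      (gradingEnd e deg * X.baseChange ℂ * (1 - gradingEnd e deg)) * h')
    (heP : e' * gradingEnd e deg = gradingEnd e deg * e')
    (heE : e' * (gradingEnd e deg * X.baseChange ℂ * (1 - gradingEnd e deg)) =
      (gradingEnd e deg * X.baseChange ℂ * (1 - gradingEnd e deg)) * e')
    (hfP : f' * gradingEnd e deg = gradingEnd e deg * f')
    (hfE : f' * (gradingEnd e deg * X.baseChange ℂ * (1 - gradingEnd e deg)) =
      (gradingEnd e deg * X.baseChange ℂ * (1 - gradingEnd e deg)) * f')
    (hhe : h' * e' - e' * h' = (2 : ℂ) • e') (hhf : h' * f' - f' * h' = -((2 : ℂ) • f'))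
    (hef : e' * f' - f' * e' = h')
    (hspan : ∀ K ∈ H.hodgeLieC, K * gradingEnd e deg = gradingEnd e deg * K →
      K * (gradingEnd e deg * X.baseChange ℂ * (1 - gradingEnd e deg)) =
        (gradingEnd e deg * X.baseChange ℂ * (1 - gradingEnd e deg)) * K →
      ∃ a b c : ℂ, K = a • h' + b • e' + c • f') :
    casimir h' e' f' - (3 : ℂ) • 1 ∈
      Submodule.span ℂ ((fun c : Module.End ℚ V => c.baseChange ℂ) '' (H.endAlg : Set (Module.End ℚ V))) := by
  -- the `sl₂` relations in the form of `Sl2CasimirCommute`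
  have hHE : h' * e' = e' * h' + (2 : ℂ) • e' := sub_eq_iff_eq_add'.1 hhe
  have hHF : h' * f' = f' * h' - (2 : ℂ) • f' := by rw [sub_eq_iff_eq_add'.1 hhf, sub_eq_add_neg]
  have hEF : e' * f' = f' * e' + h' := sub_eq_iff_eq_add'.1 hef
  -- `C` commutes with everything that commutes with `h′, e′, f′`
  have hcommC : ∀ T : Module.End ℂ (ℂ ⊗[ℚ] V), h' * T = T * h' → e' * T = T * e' → f' * T = T * f' →
      casimir h' e' f' * T = T * casimir h' e' f' := by
    intro T hh he hf
    have h1 : f' * e' * T = T * (f' * e') := by rw [mul_assoc, he, ← mul_assoc, hf, mul_assoc]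
    have h2 : h' * h' * T = T * (h' * h') := by rw [mul_assoc, hh, ← mul_assoc, hh, mul_assoc]
    simp only [casimir, add_mul, mul_add, smul_mul_assoc, mul_smul_comm, h1, h2, hh]
  obtain ⟨hhF, hhΘ⟩ := commute_of_plusLine H ψ hn e hF hFc hdeg hX hXE hplus hminus hz hhP hhE
  obtain ⟨heF, heΘ⟩ := commute_of_plusLine H ψ hn e hF hFc hdeg hX hXE hplus hminus hz heP heE
  obtain ⟨hfF, hfΘ⟩ := commute_of_plusLine H ψ hn e hF hFc hdeg hX hXE hplus hminus hz hfP hfE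
  have hCE := hcommC _ hhE heE hfE
  have hCF := hcommC _ hhF heF hfF
  have hCΘ := hcommC _ hhΘ heΘ hfΘ
  have hCh : casimir h' e' f' * h' = h' * casimir h' e' f' := casimir_mul_H hHE hHF
  have hCe : casimir h' e' f' * e' = e' * casimir h' e' f' := casimir_mul_E hHE hEF
  have hCf : casimir h' e' f' * f' = f' * casimir h' e' f' := casimir_mul_F hHF hEF
  refine mem_span_endAlg_of_forall_commute H fun X₁ hX₁ => ?_
  obtain ⟨c, c', d, K, hKM, hKP, hKE, hdec⟩ :=
    exists_decomposition_of_plusLine H hn e hF hFc hdeg hX hplus hminus (H.baseChange_mem_hodgeLieC hX₁)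
  obtain ⟨a, b, c₃, hK⟩ := hspan K hKM hKP hKE
  have hcas : casimir h' e' f' * X₁.baseChange ℂ = X₁.baseChange ℂ * casimir h' e' f' := by
    rw [hdec, hK]
    simp only [mul_add, add_mul, mul_smul_comm, smul_mul_assoc, hCE, hCF, hCΘ, hCh, hCe, hCf]
  rw [sub_mul, mul_sub, smul_mul_assoc, mul_smul_comm, one_mul, mul_one, hcas]

/-! ## §3 The trace form is non-degenerate on `𝒞 = End_Hdg ⊗ ℂ` (any weight) -/

omit [HodgeTensorFacts.{u, u}] in
/-- **The trace form `tr_{V_ℂ}(z z′)` is non-degenerate on `𝒞 = span_ℂ {a_ℂ : a ∈ End_Hdg(V)}`** for every polarizable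
Hodge structure (any weight): a non-zero `w ∈ 𝒞` orthogonal to `𝒞` would give, by descent of degeneracy
(`exists_ne_zero_orthogonal_of_spanC`), a non-zero rational `a ∈ End_Hdg` with `tr(a′ a) = 0` for all `a′ ∈ End_Hdg`,
contradicting `tr(a† a) > 0` for the Rosati adjoint `a† ∈ End_Hdg`. [cite: Moonen2017FamiliesMotives, §2.1 (p. 3)]
[cite: Deligne1982HodgeCycles, I §3 (3.4–3.6)] -/
theorem eq_zero_of_mem_spanC_endAlg_of_forall_trace_mul_eq_zero (H : HodgeStructure V n) (ψ : H.Polarization)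
    {w : Module.End ℂ (ℂ ⊗[ℚ] V)}
    (hw : w ∈ Submodule.span ℂ ((fun c : Module.End ℚ V => c.baseChange ℂ) '' (H.endAlg : Set (Module.End ℚ V))))
    (hrad : ∀ z ∈ Submodule.span ℂ ((fun c : Module.End ℚ V => c.baseChange ℂ) '' (H.endAlg : Set (Module.End ℚ V))),
      LinearMap.trace ℂ (ℂ ⊗[ℚ] V) (z * w) = 0) : w = 0 := by
  classical
  obtain ⟨𝔤, h𝔤⟩ : ∃ 𝔤 : Submodule ℚ (Module.End ℚ V), 𝔤 = Subalgebra.toSubmodule H.endAlg := ⟨_, rfl⟩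
  have h𝔤' : Submodule.span ℂ ((fun c : Module.End ℚ V => c.baseChange ℂ) '' (H.endAlg : Set (Module.End ℚ V))) =
      spanC 𝔤 := by rw [h𝔤]; rfl
  have hmem𝔤 : ∀ {a : Module.End ℚ V}, a ∈ 𝔤 ↔ a ∈ H.endAlg := fun {a} => by rw [h𝔤, Subalgebra.mem_toSubmodule]
  -- the rational trace form on `End_Hdg`
  obtain ⟨β, hβ⟩ : ∃ β : LinearMap.BilinForm ℚ 𝔤, ∀ a a', β a a' = LinearMap.trace ℚ V ((a : Module.End ℚ V) * a') :=
    ⟨LinearMap.mk₂ ℚ (fun a a' : 𝔤 => LinearMap.trace ℚ V ((a : Module.End ℚ V) * a'))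
      (fun a a' a'' => by simp only [Submodule.coe_add, add_mul, map_add])
      (fun c a a' => by simp only [Submodule.coe_smul, smul_mul_assoc, map_smul])
      (fun a a' a'' => by simp only [Submodule.coe_add, mul_add, map_add])
      (fun c a a' => by simp only [Submodule.coe_smul, mul_smul_comm, map_smul]), fun _ _ => rfl⟩
  -- the complex trace form on `𝒞`
  obtain ⟨β', hβ'⟩ : ∃ β' : spanC 𝔤 → spanC 𝔤 → ℂ, ∀ z z', β' z z' =
      LinearMap.trace ℂ (ℂ ⊗[ℚ] V) ((z : Module.End ℂ (ℂ ⊗[ℚ] V)) * z') := ⟨_, fun _ _ => rfl⟩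
  have hadd : ∀ y x x' : spanC 𝔤, β' y (x + x') = β' y x + β' y x' := by
    intro y x x'; rw [hβ', hβ', hβ', Submodule.coe_add, mul_add, map_add]
  have hsmul : ∀ (c : ℂ) (y x : spanC 𝔤), β' y (c • x) = c * β' y x := by
    intro c y x; rw [hβ', hβ', Submodule.coe_smul, mul_smul_comm, map_smul, smul_eq_mul]
  have hcompat : ∀ (a a' : 𝔤) (ha : (a : Module.End ℚ V).baseChange ℂ ∈ spanC 𝔤)
      (ha' : (a' : Module.End ℚ V).baseChange ℂ ∈ spanC 𝔤), β' ⟨_, ha⟩ ⟨_, ha'⟩ = algebraMap ℚ ℂ (β a a') := by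
    intro a a' ha ha'
    rw [hβ', hβ]
    change LinearMap.trace ℂ (ℂ ⊗[ℚ] V) ((a : Module.End ℚ V).baseChange ℂ * (a' : Module.End ℚ V).baseChange ℂ) = _
    rw [← LinearMap.baseChange_mul, LinearMap.trace_baseChange]
  -- descent and positivity
  rw [h𝔤'] at hw hrad
  by_contra hw0
  obtain ⟨a, ha0, harad⟩ := exists_ne_zero_orthogonal_of_spanC 𝔤 (spanC 𝔤) rfl β β' hadd hsmul hcompat (x' := ⟨w, hw⟩)
    (fun h => hw0 (congrArg Subtype.val h)) (fun z' => by rw [hβ']; exact hrad z'.1 z'.2)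
  have haE : (a : Module.End ℚ V) ∈ H.endAlg := hmem𝔤.1 a.2
  have h := harad ⟨ψ.adjoint a, hmem𝔤.2 (ψ.adjoint_mem_endAlg haE)⟩
  rw [hβ] at h
  have hpos := ψ.trace_adjoint_mul_self_pos haE fun h0 => ha0 (Subtype.ext h0)
  change 0 < LinearMap.trace ℚ V (ψ.adjoint a * a) at hpos
  rw [h] at hpos
  exact lt_irrefl _ hpos

/-! ## §4 `C = 3` and the standard form -/

/-- **The Casimir operator of an `sl₂`-triple spanning `𝔨` equals `3`** (type III, `𝔷 = 0`, `Lie Hg` `ℚ`-simple, triple with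
`tr(h′²) = d`, `2 tr(e′f′) = d`): `C − 3 ∈ 𝒞` is orthogonal to `𝒞` for the non-degenerate trace form.
[cite: MoonenZarhin1999LowDim, §2 (2.3)] [cite: FultonHarris1991, Lecture 11 (§11.1)]
[cite: Deligne1982HodgeCycles, I §3 (3.4–3.6)] -/
theorem casimir_eq_three_of_plusLine (H : HodgeStructure V n) (ψ : H.Polarization) (hn : n = 1)
    (e : Module.Basis S ℂ (ℂ ⊗[ℚ] V)) (hF : ∀ a, H.F a = Submodule.span ℂ (e '' {σ | a ≤ deg σ}))
    (hFc : ∀ a, complexConj (H.F a) = Submodule.span ℂ (e '' {σ | deg σ ≤ n - a}))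
    (hdeg : ∀ σ, deg σ = 0 ∨ deg σ = 1) {X : Module.End ℚ V} (hX : X ∈ H.hodgeLie) (hXE : X ∉ H.endAlg)
    (hplus : ∀ Y ∈ H.hodgeLieC, ∃ c : ℂ,
      gradingEnd e deg * Y * (1 - gradingEnd e deg) = c • (gradingEnd e deg * X.baseChange ℂ * (1 - gradingEnd e deg)))
    (hminus : ∀ Y ∈ H.hodgeLieC, ∃ c : ℂ,
      (1 - gradingEnd e deg) * Y * gradingEnd e deg = c • ((1 - gradingEnd e deg) * X.baseChange ℂ * gradingEnd e deg))
    (hz : H.hodgeLie ⊓ Subalgebra.toSubmodule H.endAlg = ⊥)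
    (hsimple : letI : LieRing (Module.End ℚ V) := LieRing.ofAssociativeRing
      ∀ 𝔏 : LieSubalgebra ℚ (Module.End ℚ V), 𝔏.toSubmodule = H.hodgeLie → LieAlgebra.IsSimple ℚ 𝔏)
    {h' e' f' : Module.End ℂ (ℂ ⊗[ℚ] V)}
    (hh' : h' ∈ H.hodgeLieC ∧ h' * gradingEnd e deg = gradingEnd e deg * h' ∧
      h' * (gradingEnd e deg * X.baseChange ℂ * (1 - gradingEnd e deg)) =
        (gradingEnd e deg * X.baseChange ℂ * (1 - gradingEnd e deg)) * h')
    (he' : e' ∈ H.hodgeLieC ∧ e' * gradingEnd e deg = gradingEnd e deg * e' ∧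
      e' * (gradingEnd e deg * X.baseChange ℂ * (1 - gradingEnd e deg)) =
        (gradingEnd e deg * X.baseChange ℂ * (1 - gradingEnd e deg)) * e')
    (hf' : f' ∈ H.hodgeLieC ∧ f' * gradingEnd e deg = gradingEnd e deg * f' ∧
      f' * (gradingEnd e deg * X.baseChange ℂ * (1 - gradingEnd e deg)) =
        (gradingEnd e deg * X.baseChange ℂ * (1 - gradingEnd e deg)) * f')
    (hhe : h' * e' - e' * h' = (2 : ℂ) • e') (hhf : h' * f' - f' * h' = -((2 : ℂ) • f'))
    (hef : e' * f' - f' * e' = h')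
    (hspan : ∀ K ∈ H.hodgeLieC, K * gradingEnd e deg = gradingEnd e deg * K →
      K * (gradingEnd e deg * X.baseChange ℂ * (1 - gradingEnd e deg)) =
        (gradingEnd e deg * X.baseChange ℂ * (1 - gradingEnd e deg)) * K →
      ∃ a b c : ℂ, K = a • h' + b • e' + c • f')
    (htrh : LinearMap.trace ℂ (ℂ ⊗[ℚ] V) (h' * h') = (Module.finrank ℚ V : ℂ))
    (htref : 2 * LinearMap.trace ℂ (ℂ ⊗[ℚ] V) (e' * f') = (Module.finrank ℚ V : ℂ)) :
    casimir h' e' f' = (3 : ℂ) • 1 := by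
  have hmem := casimir_sub_three_mem_spanC_endAlg H ψ hn e hF hFc hdeg hX hXE hplus hminus hz hh'.2.1 hh'.2.2 he'.2.1
    he'.2.2 hf'.2.1 hf'.2.2 hhe hhf hef hspan
  have h0 := eq_zero_of_mem_spanC_endAlg_of_forall_trace_mul_eq_zero H ψ hmem fun z hzm =>
    trace_mul_casimir_sub_three_eq_zero H ψ hn e hF hFc hdeg hX hXE hplus hminus hz hsimple hh'.1 he'.1 hf'.1 hef htrh
      htref hzm
  exact sub_eq_zero.1 h0

/-- **Standard form of the `sl₂`-triple spanning `𝔨`**: `h′² = 1`, `e′² = f′² = 0`, `e′f′ = ½(1 + h′)`, `f′e′ = ½(1 − h′)`,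
`h′e′ = e′`, `e′h′ = −e′`, `h′f′ = −f′`, `f′h′ = f′` — `V_ℂ` is a sum of copies of the standard representation of
`𝔨 ≅ sl₂(ℂ)` (Casimir `3`, `Sl2.weightOne_of_casimir_eq_three`), as it is for `𝔰 = ⟨E, F, Θ⟩`.
[cite: MoonenZarhin1999LowDim, §2 (2.3)] [cite: FultonHarris1991, Lecture 11 (§11.1)] -/
theorem standardForm_of_plusLine (H : HodgeStructure V n) (ψ : H.Polarization) (hn : n = 1)
    (e : Module.Basis S ℂ (ℂ ⊗[ℚ] V)) (hF : ∀ a, H.F a = Submodule.span ℂ (e '' {σ | a ≤ deg σ}))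
    (hFc : ∀ a, complexConj (H.F a) = Submodule.span ℂ (e '' {σ | deg σ ≤ n - a}))
    (hdeg : ∀ σ, deg σ = 0 ∨ deg σ = 1) {X : Module.End ℚ V} (hX : X ∈ H.hodgeLie) (hXE : X ∉ H.endAlg)
    (hplus : ∀ Y ∈ H.hodgeLieC, ∃ c : ℂ,
      gradingEnd e deg * Y * (1 - gradingEnd e deg) = c • (gradingEnd e deg * X.baseChange ℂ * (1 - gradingEnd e deg)))
    (hminus : ∀ Y ∈ H.hodgeLieC, ∃ c : ℂ,
      (1 - gradingEnd e deg) * Y * gradingEnd e deg = c • ((1 - gradingEnd e deg) * X.baseChange ℂ * gradingEnd e deg))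
    (hz : H.hodgeLie ⊓ Subalgebra.toSubmodule H.endAlg = ⊥)
    (hsimple : letI : LieRing (Module.End ℚ V) := LieRing.ofAssociativeRing
      ∀ 𝔏 : LieSubalgebra ℚ (Module.End ℚ V), 𝔏.toSubmodule = H.hodgeLie → LieAlgebra.IsSimple ℚ 𝔏)
    {h' e' f' : Module.End ℂ (ℂ ⊗[ℚ] V)}
    (hh' : h' ∈ H.hodgeLieC ∧ h' * gradingEnd e deg = gradingEnd e deg * h' ∧
      h' * (gradingEnd e deg * X.baseChange ℂ * (1 - gradingEnd e deg)) =
        (gradingEnd e deg * X.baseChange ℂ * (1 - gradingEnd e deg)) * h')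
    (he' : e' ∈ H.hodgeLieC ∧ e' * gradingEnd e deg = gradingEnd e deg * e' ∧
      e' * (gradingEnd e deg * X.baseChange ℂ * (1 - gradingEnd e deg)) =
        (gradingEnd e deg * X.baseChange ℂ * (1 - gradingEnd e deg)) * e')
    (hf' : f' ∈ H.hodgeLieC ∧ f' * gradingEnd e deg = gradingEnd e deg * f' ∧
      f' * (gradingEnd e deg * X.baseChange ℂ * (1 - gradingEnd e deg)) =
        (gradingEnd e deg * X.baseChange ℂ * (1 - gradingEnd e deg)) * f')
    (hhe : h' * e' - e' * h' = (2 : ℂ) • e') (hhf : h' * f' - f' * h' = -((2 : ℂ) • f'))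
    (hef : e' * f' - f' * e' = h')
    (hspan : ∀ K ∈ H.hodgeLieC, K * gradingEnd e deg = gradingEnd e deg * K →
      K * (gradingEnd e deg * X.baseChange ℂ * (1 - gradingEnd e deg)) =
        (gradingEnd e deg * X.baseChange ℂ * (1 - gradingEnd e deg)) * K →
      ∃ a b c : ℂ, K = a • h' + b • e' + c • f')
    (htrh : LinearMap.trace ℂ (ℂ ⊗[ℚ] V) (h' * h') = (Module.finrank ℚ V : ℂ))
    (htref : 2 * LinearMap.trace ℂ (ℂ ⊗[ℚ] V) (e' * f') = (Module.finrank ℚ V : ℂ)) :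
    h' * h' = 1 ∧ e' * e' = 0 ∧ f' * f' = 0 ∧ e' * f' = (2 : ℂ)⁻¹ • (1 + h') ∧ f' * e' = (2 : ℂ)⁻¹ • (1 - h') ∧
      h' * e' = e' ∧ e' * h' = -e' ∧ h' * f' = -f' ∧ f' * h' = f' := by
  have hC := casimir_eq_three_of_plusLine H ψ hn e hF hFc hdeg hX hXE hplus hminus hz hsimple hh' he' hf' hhe hhf hef hspan
    htrh htref
  have hHE : h' * e' = e' * h' + (2 : ℂ) • e' := sub_eq_iff_eq_add'.1 hhe
  have hHF : h' * f' = f' * h' - (2 : ℂ) • f' := by rw [sub_eq_iff_eq_add'.1 hhf, sub_eq_add_neg]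
  have hEF : e' * f' = f' * e' + h' := sub_eq_iff_eq_add'.1 hef
  exact weightOne_of_casimir_eq_three hHE hHF hEF hC

end HodgeStructure

end Literature.AlgebraicGeometry.Motives

end
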